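import Summits.QuantumFields.YangMills.Theorems.FluctuationComparisonRegPrIntLVirialFlowDiff
import HarnessLib

/-!
# `FluctuationComparisonRegPrIntLVirialFlowReduction` — LINE g20-1 «VIRIAL FLOW FOR H4ᶜ», IMPORTABLE: H4ᶜ ⟸ FMIX ALONE (DIFF discharged by ✓`…VirialFlowDiff`)
# (crux `UnitScaleTilt.FluctuationComparisonRegPrIntL`, stmt-QuantumFields-20520; organ H4ᶜ `BeyondOneLoopSmallCan`; line file `Cruxes/…/Lines/virial_flow.lean` v1.2)

Cell `ym3-torus` (YM ladder rung R3 = continuum SU(2) Yang–Mills on T³ — a RUNG, NOT the Clay problem: not d = 4, not infinite volume, not a mass gap);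
width seat `ym3-torus-px19` (gen 11); helper `--supports stmt-QuantumFields-20520`.  THEOREMS ONLY (0 `def`, 0 `sorry`, default heartbeats).

WHY (★★OWNER RULING №37 (3): «a registered row whose signature is a by-name Prop must name a decl in an IMPORTABLE module or carry the FULL Prop text —
Lines-local names make the registry unable to see closures»).  LINE g20-1 proves H4ᶜ ⟸ DIFF ∧ FMIX inside the Cruxes file, which no Theorems∕Cruxes module can
import; DIFF is ✓p752011.  This file RE-TYPES the line's §1∕§3 over importable letters — every `fluctAtCan`, `flowCan`, `fourPt`, `oneLoopFourPtCan` of the line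
UNFOLDED over ✓`…WregGlue.heightDensityCan` (delta-equal to the line's) — so that the consolidating skeleton (№36 (4)∕№37 (2)) can register FMIX (full text) as the
H4ᶜ-lane row and close H4ᶜ BY NAME: `theorem stub_beyondOneLoopSmallCan : BeyondOneLoopSmallCan := beyondOneLoopSmallCan_of_flowFourPtDecayCan stub_flowFourPtDecayCan`.
* §1 generic calculus (the line's §3 core, letters-free): `integral_Ioi_one_rpow_neg_succ` · ★`abs_sub_limUnder_le_of_deriv_bound` (FTC on `[1,∞)` + existence of the
  limit from an integrable derivative) · ★★`fourPt_flow_reduction` — for ANY family `f : ℝ → X → ℝ` differentiable in the parameter on `[1,∞)` at four points with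
  `|Δ²(x·∂ₓf)| ≤ A·x^(−η)`: `Δ² f(x) → Λ` and `|Δ² f(1) − Λ| ≤ A∕η`, `Λ := limUnder`;
* §2 ★★★`beyondOneLoopSmallCan_of_flowFourPtDecayCan : ⟨FMIX `FlowFourPtDecayCan`, unfolded⟩ → ⟨H4ᶜ `BeyondOneLoopSmallCan`, unfolded⟩` (`φ₂ := Φ∕η`; DIFF from
  ✓`fluctDifferentiableCan`, thresholds merged by `max`∕`min` exactly as in the line) · ★`oneLoopFourPt_tendsto_of_flowFourPtDecayCan` (1L4ᶜ's clause (T) on window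
  quadruples ⟸ FMIX).
HONEST SCOPE.  A port of kernel-checked Cruxes proofs (ideator ym-r3-idea-1 g20) to an importable module; proves nothing new: FMIX (the XL organ), H4ᶜ, S2β,
`FluctuationComparisonRegPrIntL` 20520 and `YM3TorusSU2` are NOT proved; no summit statement is proved; the Yang–Mills mass gap is NOT proved.
References: [Balaban1985UV3] (41)–(47) pp. 266–267; [Michael1987] (2.3) (action sum rule ∕ coupling-constant integration).
-/

noncomputable section

set_option autoImplicit false

open MeasureTheory Filter Topology Set
open Literature.MathematicalPhysics.QuantumFieldTheory.Balaban1983to89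
open Literature.MathematicalPhysics.QuantumFieldTheory.Balaban1983to89.T3ContinuumYM3Torus
open Literature.MathematicalPhysics.QuantumFieldTheory.Balaban1983to89.T3UnitLawDensityEML
open Literature.MathematicalPhysics.QuantumFieldTheory.Balaban1983to89.T3UnitScaleTilt
open Literature.MathematicalPhysics.QuantumFieldTheory.Balaban1983to89.T3PrintedRegularMinimiser
open Summit.QuantumFields.YangMills.Theorems.FluctuationComparisonRegPrIntLWregGlue (heightDensityCan)
open Summit.QuantumFields.YangMills.Theorems.FluctuationComparisonRegPrIntLVirialFlowDiff (fluctDifferentiableCan)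

namespace Summit.QuantumFields.YangMills.Theorems.FluctuationComparisonRegPrIntLVirialFlowReduction

/-! ## §1 Generic calculus: an integrable `x^(−(η+1))` derivative bound forces convergence and controls `|g 1 − lim g|` -/

/-- `∫_1^∞ t^(−(η+1)) dt = 1∕η` for `η > 0`. [cite: Michael1987, (2.3)] -/
theorem integral_Ioi_one_rpow_neg_succ (η : ℝ) (hη : 0 < η) : ∫ t : ℝ in Ioi 1, t ^ (-(η + 1)) = 1 / η := by
  rw [integral_Ioi_rpow_of_lt (by linarith : (-(η + 1) : ℝ) < -1) one_pos, Real.one_rpow]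
  have hne : (-(η + 1) + 1 : ℝ) ≠ 0 := by intro h; linarith
  field_simp
  ring

/-- ★ **THE CORE ESTIMATE**: if `g` has derivative `g′` on `[1,∞)` with `|g′ x| ≤ M·x^(−(η+1))`, `g′` measurable, then `g` converges at `∞` and `|g 1 − lim g| ≤ M∕η`
(FTC on `[1, ∞)`, `integral_Ioi_of_hasDerivAt_of_tendsto'`; the limit's existence from the integrable derivative, `tendsto_limUnder_of_hasDerivAt_of_integrableOn_Ioi`).
[cite: Michael1987, (2.3)] -/
theorem abs_sub_limUnder_le_of_deriv_bound {g g' : ℝ → ℝ} {M η : ℝ} (hη : 0 < η)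
    (hderiv : ∀ x ∈ Ici (1 : ℝ), HasDerivAt g (g' x) x) (hmeas : Measurable g')
    (hbound : ∀ x : ℝ, 1 ≤ x → |g' x| ≤ M * x ^ (-(η + 1))) :
    Tendsto g atTop (𝓝 (limUnder atTop g)) ∧ |g 1 - limUnder atTop g| ≤ M / η := by
  have hG : IntegrableOn (fun x : ℝ => M * x ^ (-(η + 1))) (Ioi 1) :=
    (integrableOn_Ioi_rpow_of_lt (by linarith : (-(η + 1) : ℝ) < -1) one_pos).const_mul M
  have hae : ∀ᵐ x ∂(volume.restrict (Ioi (1 : ℝ))), ‖g' x‖ ≤ M * x ^ (-(η + 1)) := by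
    rw [ae_restrict_iff' measurableSet_Ioi]
    exact Eventually.of_forall fun x hx => by
      rw [Real.norm_eq_abs]; exact hbound x (le_of_lt hx)
  have hint : IntegrableOn g' (Ioi 1) := Integrable.mono' hG hmeas.aestronglyMeasurable hae
  have hlim : Tendsto g atTop (𝓝 (limUnder atTop g)) :=
    tendsto_limUnder_of_hasDerivAt_of_integrableOn_Ioi (fun x hx => hderiv x (Set.mem_Ici.mpr (le_of_lt hx))) hint
  refine ⟨hlim, ?_⟩
  have hftc : ∫ x in Ioi 1, g' x = limUnder atTop g - g 1 := integral_Ioi_of_hasDerivAt_of_tendsto' hderiv hint hlim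
  have hnorm : ‖∫ x in Ioi 1, g' x‖ ≤ ∫ x in Ioi 1, M * x ^ (-(η + 1)) := norm_integral_le_of_norm_le hG hae
  rw [integral_const_mul, integral_Ioi_one_rpow_neg_succ η hη, hftc, Real.norm_eq_abs] at hnorm
  rw [abs_sub_comm]
  calc |limUnder atTop g - g 1| ≤ M * (1 / η) := hnorm
    _ = M / η := by ring

/-- ★★ **THE FLOW REDUCTION, LETTERS-FREE**: for any family `f : ℝ → X → ℝ`, four points `U V W Z : X`, `η > 0`, `A`, if `x ↦ f x P` is differentiable at every
`x ≥ 1` for `P ∈ {U, V, W, Z}` and the connected 4-point of the FLOW `x·∂ₓf` is `≤ A·x^(−η)` for `x ≥ 1`, then the 4-point of `f` converges as `x → ∞` and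
`|Δ²f(1) − lim Δ²f| ≤ A∕η`. [cite: Michael1987, (2.3); Balaban1985UV3, (45)-(47) p.267] -/
theorem fourPt_flow_reduction {X : Type*} (f : ℝ → X → ℝ) (U V W Z : X) {A η : ℝ} (hη : 0 < η)
    (hdiff : ∀ x : ℝ, 1 ≤ x → DifferentiableAt ℝ (fun μ : ℝ => f μ U) x ∧ DifferentiableAt ℝ (fun μ : ℝ => f μ V) x ∧
      DifferentiableAt ℝ (fun μ : ℝ => f μ W) x ∧ DifferentiableAt ℝ (fun μ : ℝ => f μ Z) x)
    (hflow : ∀ x : ℝ, 1 ≤ x →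
      |((x * deriv (fun μ : ℝ => f μ U) x - x * deriv (fun μ : ℝ => f μ V) x)
          - (x * deriv (fun μ : ℝ => f μ W) x - x * deriv (fun μ : ℝ => f μ Z) x))| ≤ A * x ^ (-η)) :
    Tendsto (fun x : ℝ => (f x U - f x V) - (f x W - f x Z)) atTop
        (𝓝 (limUnder atTop (fun x : ℝ => (f x U - f x V) - (f x W - f x Z)))) ∧
      |((f 1 U - f 1 V) - (f 1 W - f 1 Z)) - limUnder atTop (fun x : ℝ => (f x U - f x V) - (f x W - f x Z))| ≤ A / η := by
  set g : ℝ → ℝ := fun x => (f x U - f x V) - (f x W - f x Z) with hg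
  set g' : ℝ → ℝ := fun x => ((x * deriv (fun μ : ℝ => f μ U) x - x * deriv (fun μ : ℝ => f μ V) x)
      - (x * deriv (fun μ : ℝ => f μ W) x - x * deriv (fun μ : ℝ => f μ Z) x)) / x with hg'
  have hderiv : ∀ x ∈ Ici (1 : ℝ), HasDerivAt g (g' x) x := by
    intro x hx
    have hx1 : (1 : ℝ) ≤ x := hx
    have hx0 : x ≠ 0 := by intro h; rw [h] at hx1; linarith
    obtain ⟨hU, hV, hW, hZ⟩ := hdiff x hx1
    have h := (hU.hasDerivAt.sub hV.hasDerivAt).sub (hW.hasDerivAt.sub hZ.hasDerivAt)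
    refine h.congr_deriv ?_
    simp only [hg']
    field_simp
  have hmeas : Measurable g' := by
    have hd : ∀ P : X, Measurable (fun x : ℝ => x * deriv (fun μ : ℝ => f μ P) x) := fun P => measurable_id.mul (measurable_deriv _)
    exact (((hd U).sub (hd V)).sub ((hd W).sub (hd Z))).div measurable_id
  have hbound : ∀ x : ℝ, 1 ≤ x → |g' x| ≤ A * x ^ (-(η + 1)) := by
    intro x hx1
    have hx0 : 0 < x := by linarith
    have h4 := hflow x hx1
    have hsplit : x ^ (-(η + 1)) = x ^ (-η) * x⁻¹ := by
      rw [show (-(η + 1) : ℝ) = -η + (-1) by ring, Real.rpow_add hx0, Real.rpow_neg_one]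
    simp only [hg']
    rw [abs_div, abs_of_pos hx0, div_eq_mul_inv, hsplit, ← mul_assoc]
    exact mul_le_mul_of_nonneg_right h4 (inv_nonneg.mpr hx0.le)
  have hcore := abs_sub_limUnder_le_of_deriv_bound hη hderiv hmeas hbound
  exact ⟨hcore.1, hcore.2⟩

/-! ## §2 H4ᶜ ⟸ FMIX (DIFF inside), and 1L4ᶜ's clause (T) ⟸ FMIX — the line's texts unfolded over importable letters -/

/-- ★★★ **H4ᶜ ⟸ FMIX** (LINE g20-1's `beyondOneLoopSmallCan_of_flow` with DIFF := ✓`fluctDifferentiableCan`): the hypothesis is FMIX `FlowFourPtDecayCan` and the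
conclusion is H4ᶜ `BeyondOneLoopSmallCan`, both VERBATIM with `fluctAtCan`∕`flowCan`∕`fourPt`∕`oneLoopFourPtCan` unfolded (`heightDensityCan` = ✓WregGlue's), so the
line closes `stub_beyondOneLoopSmallCan := beyondOneLoopSmallCan_of_flowFourPtDecayCan stub_flowFourPtDecayCan` by `delta`; `φ₂ J := Φ J ∕ η`.
[cite: Balaban1985UV3, (45)-(47) p.267; Michael1987, (2.3)] -/
theorem beyondOneLoopSmallCan_of_flowFourPtDecayCan
    (hM :
    ∀ (L : ℕ), ∃ pS : ℝ, ∀ (b₀ p₀ : ℝ), 0 < b₀ → pS ≤ p₀ → 0 < p₀ → ∃ ε₁ : ℝ, 0 < ε₁ ∧ ∀ (ε₀ : ℝ), 0 < ε₀ → ε₀ ≤ ε₁ →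
      ∃ γ₁ : ℝ, 0 < γ₁ ∧ ∃ κ : ℝ, 0 < κ ∧ ∀ (F : T3Family) (γ : ℝ), F.L = L → 0 < γ → γ ≤ γ₁ →
        ∃ Φ : ℕ → ℝ, (∀ J, 0 ≤ Φ J) ∧ Tendsto (fun J : ℕ => (J : ℝ) * Φ J) atTop (𝓝 0) ∧ ∃ η : ℝ, 0 < η ∧
          ∀ (J K : ℕ) (hJK : J ≤ K) (b b' : PBond (F.P J) 0) (U V W Z : GaugeField (F.P J) 0 (Matrix.specialUnitaryGroup (Fin 2) ℂ)),
            PlaqSmall (θBal F.L γ b₀ p₀ J) U → PlaqSmall (θBal F.L γ b₀ p₀ J) V →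
            PlaqSmall (θBal F.L γ b₀ p₀ J) W → PlaqSmall (θBal F.L γ b₀ p₀ J) Z →
            (∀ e, e ≠ b → U e = V e) → (∀ e, e ≠ b' → U e = W e) → (∀ e, e ≠ b' → V e = Z e) → (∀ e, e ≠ b → W e = Z e) →
            ∀ lam : ℝ, 1 ≤ lam →
              |(((lam * deriv (fun μ : ℝ => Real.log (heightDensityCan F (γ / μ) hJK (histGood F ℰp (θBal F.L γ b₀ p₀) K J) U)
                + (F.scheme ℰp (γ / μ)).β K * minActionRegPr F J K hJK ε₀ U) lam) - (lam * deriv (fun μ : ℝ => Real.log (heightDensityCan F (γ / μ) hJK (histGood F ℰp (θBal F.L γ b₀ p₀) K J) V)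
                + (F.scheme ℰp (γ / μ)).β K * minActionRegPr F J K hJK ε₀ V) lam))
              - ((lam * deriv (fun μ : ℝ => Real.log (heightDensityCan F (γ / μ) hJK (histGood F ℰp (θBal F.L γ b₀ p₀) K J) W)
                + (F.scheme ℰp (γ / μ)).β K * minActionRegPr F J K hJK ε₀ W) lam) - (lam * deriv (fun μ : ℝ => Real.log (heightDensityCan F (γ / μ) hJK (histGood F ℰp (θBal F.L γ b₀ p₀) K J) Z)
                + (F.scheme ℰp (γ / μ)).β K * minActionRegPr F J K hJK ε₀ Z) lam)))|
                ≤ Φ J * lam ^ (-η) * Real.exp (-(κ * (b.src.tdist b'.src : ℝ)))) :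
    ∀ (L : ℕ), ∃ pS : ℝ, ∀ (b₀ p₀ : ℝ), 0 < b₀ → pS ≤ p₀ → 0 < p₀ → ∃ ε₁ : ℝ, 0 < ε₁ ∧ ∀ (ε₀ : ℝ), 0 < ε₀ → ε₀ ≤ ε₁ →
      ∃ γ₁ : ℝ, 0 < γ₁ ∧ ∃ κ : ℝ, 0 < κ ∧ ∀ (F : T3Family) (γ : ℝ), F.L = L → 0 < γ → γ ≤ γ₁ →
        ∃ φ₂ : ℕ → ℝ, (∀ J, 0 ≤ φ₂ J) ∧ Tendsto (fun J : ℕ => (J : ℝ) * φ₂ J) atTop (𝓝 0) ∧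
          ∀ (J K : ℕ) (hJK : J ≤ K) (b b' : PBond (F.P J) 0) (U V W Z : GaugeField (F.P J) 0 (Matrix.specialUnitaryGroup (Fin 2) ℂ)),
            PlaqSmall (θBal F.L γ b₀ p₀ J) U → PlaqSmall (θBal F.L γ b₀ p₀ J) V →
            PlaqSmall (θBal F.L γ b₀ p₀ J) W → PlaqSmall (θBal F.L γ b₀ p₀ J) Z →
            (∀ e, e ≠ b → U e = V e) → (∀ e, e ≠ b' → U e = W e) → (∀ e, e ≠ b' → V e = Z e) → (∀ e, e ≠ b → W e = Z e) →
            |(((Real.log (heightDensityCan F (γ / 1) hJK (histGood F ℰp (θBal F.L γ b₀ p₀) K J) U)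
                + (F.scheme ℰp (γ / 1)).β K * minActionRegPr F J K hJK ε₀ U) - (Real.log (heightDensityCan F (γ / 1) hJK (histGood F ℰp (θBal F.L γ b₀ p₀) K J) V)
                + (F.scheme ℰp (γ / 1)).β K * minActionRegPr F J K hJK ε₀ V))
              - ((Real.log (heightDensityCan F (γ / 1) hJK (histGood F ℰp (θBal F.L γ b₀ p₀) K J) W)
                + (F.scheme ℰp (γ / 1)).β K * minActionRegPr F J K hJK ε₀ W) - (Real.log (heightDensityCan F (γ / 1) hJK (histGood F ℰp (θBal F.L γ b₀ p₀) K J) Z)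
                + (F.scheme ℰp (γ / 1)).β K * minActionRegPr F J K hJK ε₀ Z)))
                - limUnder atTop (fun lam : ℝ => (((Real.log (heightDensityCan F (γ / lam) hJK (histGood F ℰp (θBal F.L γ b₀ p₀) K J) U)
                + (F.scheme ℰp (γ / lam)).β K * minActionRegPr F J K hJK ε₀ U) - (Real.log (heightDensityCan F (γ / lam) hJK (histGood F ℰp (θBal F.L γ b₀ p₀) K J) V)
                + (F.scheme ℰp (γ / lam)).β K * minActionRegPr F J K hJK ε₀ V))
              - ((Real.log (heightDensityCan F (γ / lam) hJK (histGood F ℰp (θBal F.L γ b₀ p₀) K J) W)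
                + (F.scheme ℰp (γ / lam)).β K * minActionRegPr F J K hJK ε₀ W) - (Real.log (heightDensityCan F (γ / lam) hJK (histGood F ℰp (θBal F.L γ b₀ p₀) K J) Z)
                + (F.scheme ℰp (γ / lam)).β K * minActionRegPr F J K hJK ε₀ Z))))|
              ≤ φ₂ J * Real.exp (-(κ * (b.src.tdist b'.src : ℝ))) := by
  intro L
  obtain ⟨pS₁, hpS₁⟩ := fluctDifferentiableCan L
  obtain ⟨pS₂, hpS₂⟩ := hM L
  refine ⟨max pS₁ pS₂, fun b₀ p₀ hb₀ hp hp₀ => ?_⟩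
  obtain ⟨ε₁, hε₁, hε⟩ := hpS₁ b₀ p₀ hb₀ ((le_max_left _ _).trans hp) hp₀
  obtain ⟨ε₂, hε₂, hε'⟩ := hpS₂ b₀ p₀ hb₀ ((le_max_right _ _).trans hp) hp₀
  refine ⟨min ε₁ ε₂, lt_min hε₁ hε₂, fun ε₀ hε₀ hε₀₁ => ?_⟩
  obtain ⟨γ₁, hγ₁, hFam₁⟩ := hε ε₀ hε₀ (hε₀₁.trans (min_le_left _ _))
  obtain ⟨γ₂, hγ₂, κ, hκ, hFam₂⟩ := hε' ε₀ hε₀ (hε₀₁.trans (min_le_right _ _))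
  refine ⟨min γ₁ γ₂, lt_min hγ₁ hγ₂, κ, hκ, fun F γ hFL hγ hγle => ?_⟩
  have hD₁ := hFam₁ F γ hFL hγ (hγle.trans (min_le_left _ _))
  obtain ⟨Φ, hΦ0, hΦlim, η, hη, hrun⟩ := hFam₂ F γ hFL hγ (hγle.trans (min_le_right _ _))
  refine ⟨fun J => Φ J / η, fun J => div_nonneg (hΦ0 J) hη.le, ?_, ?_⟩
  · have : Tendsto (fun J : ℕ => (1 / η) * ((J : ℝ) * Φ J)) atTop (𝓝 ((1 / η) * 0)) := hΦlim.const_mul _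
    rw [mul_zero] at this
    refine this.congr' (Eventually.of_forall fun J => ?_)
    show (1 / η) * ((J : ℝ) * Φ J) = (J : ℝ) * (Φ J / η)
    ring
  · intro J K hJK b b' U V W Z hU hV hW hZ hUV hUW hVZ hWZ
    have hred := fourPt_flow_reduction
      (fun (μ : ℝ) (X : GaugeField (F.P J) 0 (Matrix.specialUnitaryGroup (Fin 2) ℂ)) =>
        Real.log (heightDensityCan F (γ / μ) hJK (histGood F ℰp (θBal F.L γ b₀ p₀) K J) X)
                + (F.scheme ℰp (γ / μ)).β K * minActionRegPr F J K hJK ε₀ X) U V W Z hη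
      (fun x hx1 => ⟨hD₁ J K hJK U hU x hx1, hD₁ J K hJK V hV x hx1, hD₁ J K hJK W hW x hx1, hD₁ J K hJK Z hZ x hx1⟩)
      (fun x hx1 => by
        have h4 := hrun J K hJK b b' U V W Z hU hV hW hZ hUV hUW hVZ hWZ x hx1
        calc _ ≤ Φ J * x ^ (-η) * Real.exp (-(κ * (b.src.tdist b'.src : ℝ))) := h4
          _ = Φ J * Real.exp (-(κ * (b.src.tdist b'.src : ℝ))) * x ^ (-η) := by ring)
    calc _ ≤ Φ J * Real.exp (-(κ * (b.src.tdist b'.src : ℝ))) / η := hred.2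
      _ = Φ J / η * Real.exp (-(κ * (b.src.tdist b'.src : ℝ))) := by ring

/-- ★ **1L4ᶜ's CLAUSE (T) ON WINDOW QUADRUPLES ⟸ FMIX** (the line's `oneLoopFourPt_tendsto_of_flow` with DIFF inside): the λ-scaled 4-point converges to the
canonical one-loop 4-point (the `limUnder`). [cite: Balaban1985Variational, Thm 1 (8) p.279; Michael1987, (2.3)] -/
theorem oneLoopFourPt_tendsto_of_flowFourPtDecayCan
    (hM :
    ∀ (L : ℕ), ∃ pS : ℝ, ∀ (b₀ p₀ : ℝ), 0 < b₀ → pS ≤ p₀ → 0 < p₀ → ∃ ε₁ : ℝ, 0 < ε₁ ∧ ∀ (ε₀ : ℝ), 0 < ε₀ → ε₀ ≤ ε₁ →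
      ∃ γ₁ : ℝ, 0 < γ₁ ∧ ∃ κ : ℝ, 0 < κ ∧ ∀ (F : T3Family) (γ : ℝ), F.L = L → 0 < γ → γ ≤ γ₁ →
        ∃ Φ : ℕ → ℝ, (∀ J, 0 ≤ Φ J) ∧ Tendsto (fun J : ℕ => (J : ℝ) * Φ J) atTop (𝓝 0) ∧ ∃ η : ℝ, 0 < η ∧
          ∀ (J K : ℕ) (hJK : J ≤ K) (b b' : PBond (F.P J) 0) (U V W Z : GaugeField (F.P J) 0 (Matrix.specialUnitaryGroup (Fin 2) ℂ)),
            PlaqSmall (θBal F.L γ b₀ p₀ J) U → PlaqSmall (θBal F.L γ b₀ p₀ J) V →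
            PlaqSmall (θBal F.L γ b₀ p₀ J) W → PlaqSmall (θBal F.L γ b₀ p₀ J) Z →
            (∀ e, e ≠ b → U e = V e) → (∀ e, e ≠ b' → U e = W e) → (∀ e, e ≠ b' → V e = Z e) → (∀ e, e ≠ b → W e = Z e) →
            ∀ lam : ℝ, 1 ≤ lam →
              |(((lam * deriv (fun μ : ℝ => Real.log (heightDensityCan F (γ / μ) hJK (histGood F ℰp (θBal F.L γ b₀ p₀) K J) U)
                + (F.scheme ℰp (γ / μ)).β K * minActionRegPr F J K hJK ε₀ U) lam) - (lam * deriv (fun μ : ℝ => Real.log (heightDensityCan F (γ / μ) hJK (histGood F ℰp (θBal F.L γ b₀ p₀) K J) V)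
                + (F.scheme ℰp (γ / μ)).β K * minActionRegPr F J K hJK ε₀ V) lam))
              - ((lam * deriv (fun μ : ℝ => Real.log (heightDensityCan F (γ / μ) hJK (histGood F ℰp (θBal F.L γ b₀ p₀) K J) W)
                + (F.scheme ℰp (γ / μ)).β K * minActionRegPr F J K hJK ε₀ W) lam) - (lam * deriv (fun μ : ℝ => Real.log (heightDensityCan F (γ / μ) hJK (histGood F ℰp (θBal F.L γ b₀ p₀) K J) Z)
                + (F.scheme ℰp (γ / μ)).β K * minActionRegPr F J K hJK ε₀ Z) lam)))|
                ≤ Φ J * lam ^ (-η) * Real.exp (-(κ * (b.src.tdist b'.src : ℝ)))) :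
    ∀ (L : ℕ), ∃ pS : ℝ, ∀ (b₀ p₀ : ℝ), 0 < b₀ → pS ≤ p₀ → 0 < p₀ → ∃ ε₁ : ℝ, 0 < ε₁ ∧ ∀ (ε₀ : ℝ), 0 < ε₀ → ε₀ ≤ ε₁ →
      ∃ γ₁ : ℝ, 0 < γ₁ ∧ ∀ (F : T3Family) (γ : ℝ), F.L = L → 0 < γ → γ ≤ γ₁ →
          ∀ (J K : ℕ) (hJK : J ≤ K) (b b' : PBond (F.P J) 0) (U V W Z : GaugeField (F.P J) 0 (Matrix.specialUnitaryGroup (Fin 2) ℂ)),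
            PlaqSmall (θBal F.L γ b₀ p₀ J) U → PlaqSmall (θBal F.L γ b₀ p₀ J) V →
            PlaqSmall (θBal F.L γ b₀ p₀ J) W → PlaqSmall (θBal F.L γ b₀ p₀ J) Z →
            (∀ e, e ≠ b → U e = V e) → (∀ e, e ≠ b' → U e = W e) → (∀ e, e ≠ b' → V e = Z e) → (∀ e, e ≠ b → W e = Z e) →
            Tendsto (fun lam : ℝ => (((Real.log (heightDensityCan F (γ / lam) hJK (histGood F ℰp (θBal F.L γ b₀ p₀) K J) U)
                + (F.scheme ℰp (γ / lam)).β K * minActionRegPr F J K hJK ε₀ U) - (Real.log (heightDensityCan F (γ / lam) hJK (histGood F ℰp (θBal F.L γ b₀ p₀) K J) V)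
                + (F.scheme ℰp (γ / lam)).β K * minActionRegPr F J K hJK ε₀ V))
              - ((Real.log (heightDensityCan F (γ / lam) hJK (histGood F ℰp (θBal F.L γ b₀ p₀) K J) W)
                + (F.scheme ℰp (γ / lam)).β K * minActionRegPr F J K hJK ε₀ W) - (Real.log (heightDensityCan F (γ / lam) hJK (histGood F ℰp (θBal F.L γ b₀ p₀) K J) Z)
                + (F.scheme ℰp (γ / lam)).β K * minActionRegPr F J K hJK ε₀ Z)))) atTop
              (𝓝 (limUnder atTop (fun lam : ℝ => (((Real.log (heightDensityCan F (γ / lam) hJK (histGood F ℰp (θBal F.L γ b₀ p₀) K J) U)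
                + (F.scheme ℰp (γ / lam)).β K * minActionRegPr F J K hJK ε₀ U) - (Real.log (heightDensityCan F (γ / lam) hJK (histGood F ℰp (θBal F.L γ b₀ p₀) K J) V)
                + (F.scheme ℰp (γ / lam)).β K * minActionRegPr F J K hJK ε₀ V))
              - ((Real.log (heightDensityCan F (γ / lam) hJK (histGood F ℰp (θBal F.L γ b₀ p₀) K J) W)
                + (F.scheme ℰp (γ / lam)).β K * minActionRegPr F J K hJK ε₀ W) - (Real.log (heightDensityCan F (γ / lam) hJK (histGood F ℰp (θBal F.L γ b₀ p₀) K J) Z)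
                + (F.scheme ℰp (γ / lam)).β K * minActionRegPr F J K hJK ε₀ Z)))))) := by
  intro L
  obtain ⟨pS₁, hpS₁⟩ := fluctDifferentiableCan L
  obtain ⟨pS₂, hpS₂⟩ := hM L
  refine ⟨max pS₁ pS₂, fun b₀ p₀ hb₀ hp hp₀ => ?_⟩
  obtain ⟨ε₁, hε₁, hε⟩ := hpS₁ b₀ p₀ hb₀ ((le_max_left _ _).trans hp) hp₀
  obtain ⟨ε₂, hε₂, hε'⟩ := hpS₂ b₀ p₀ hb₀ ((le_max_right _ _).trans hp) hp₀
  refine ⟨min ε₁ ε₂, lt_min hε₁ hε₂, fun ε₀ hε₀ hε₀₁ => ?_⟩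
  obtain ⟨γ₁, hγ₁, hFam₁⟩ := hε ε₀ hε₀ (hε₀₁.trans (min_le_left _ _))
  obtain ⟨γ₂, hγ₂, κ, hκ, hFam₂⟩ := hε' ε₀ hε₀ (hε₀₁.trans (min_le_right _ _))
  refine ⟨min γ₁ γ₂, lt_min hγ₁ hγ₂, fun F γ hFL hγ hγle => ?_⟩
  have hD₁ := hFam₁ F γ hFL hγ (hγle.trans (min_le_left _ _))
  obtain ⟨Φ, hΦ0, hΦlim, η, hη, hrun⟩ := hFam₂ F γ hFL hγ (hγle.trans (min_le_right _ _))
  intro J K hJK b b' U V W Z hU hV hW hZ hUV hUW hVZ hWZ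
  have hred := fourPt_flow_reduction
    (fun (μ : ℝ) (X : GaugeField (F.P J) 0 (Matrix.specialUnitaryGroup (Fin 2) ℂ)) =>
      Real.log (heightDensityCan F (γ / μ) hJK (histGood F ℰp (θBal F.L γ b₀ p₀) K J) X)
                + (F.scheme ℰp (γ / μ)).β K * minActionRegPr F J K hJK ε₀ X) U V W Z hη
    (fun x hx1 => ⟨hD₁ J K hJK U hU x hx1, hD₁ J K hJK V hV x hx1, hD₁ J K hJK W hW x hx1, hD₁ J K hJK Z hZ x hx1⟩)
    (fun x hx1 => by
      have h4 := hrun J K hJK b b' U V W Z hU hV hW hZ hUV hUW hVZ hWZ x hx1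
      calc _ ≤ Φ J * x ^ (-η) * Real.exp (-(κ * (b.src.tdist b'.src : ℝ))) := h4
        _ = Φ J * Real.exp (-(κ * (b.src.tdist b'.src : ℝ))) * x ^ (-η) := by ring)
  exact hred.1

end Summit.QuantumFields.YangMills.Theorems.FluctuationComparisonRegPrIntLVirialFlowReduction

end
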